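import Mathlib
import HarnessLib
import Summits.ResolutionOfSingularities.ResolutionOfSingularities.Theorems.WildQuotientsWildQuotientResolutionToricExitTransferFour
import Summits.ResolutionOfSingularities.ResolutionOfSingularities.Theorems.WildQuotientsWildQuotientResolutionBlowupExitIsBlowupPow
import Summits.ResolutionOfSingularities.ResolutionOfSingularities.Theorems.WildQuotientsWildQuotientResolutionBlowupExitColonGlue

/-!
# The toric exit transfer with FOUR pieces and a ONE-SHOT colon centre (RUNG V5, variant β‴)
(crux stmt-ResolutionOfSingularities-15640 `WildQuotients.WildQuotientResolution`, line `Sketch`;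
chain w45c RUNG V5, res-L1-w45c-plan-1 RULING v8.4-B + `L/w45c/HP0-ONESHOT-DESIGN.md` §1–§3;
[OURS · L1 W4.5c] — NOT a statement of any manuscript; replaces the role of no printed item.
Lead prover res-L1-w45c-lead-1.)

`ToricExit.toricExitTransfer₄'` — the sibling of `toricExitTransfer₄` (p525488) in which the
`μ₄` piece `O₀` is resolved by ONE blow-up along a colon centre instead of two reduced blow-ups.
Global centre on `Y = V/G`: with `𝓘 := 𝓘_{q(T)}`, `𝓘_A := 𝓘_{q(T')}` (reduced ideal sheaves of the
closed images of the closed `T, T' ⊆ V`), `𝓘′ := 𝓘 · (𝓘² : 𝓘_A)` (Literature `colon`). On the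
pieces `O₁, O₂, O₃` (which `T'` misses) `𝓘_A` pulls back to `⊤`, so `𝓘′` pulls back to `𝓘³` by
order theory alone (`le_colon_self`, `mul_colon_le`, `comap_mul`) and the one-blow-up bricks
`hP₁, hP₂` are recycled through `BlowupExit.isBlowup_pow_iff` (p529296); on `O₀` the pulled-back
centre is `𝓘_{Z₀} · (𝓘_{Z₀}² : 𝓘_{A₀})` (`BlowupExit.comap_colon_of_isOpenImmersion`, stub-5 p532809),
which is the
ONE-SHOT brick `hP₀'` of HP0-ONESHOT-DESIGN §3. Glue = the depth-one exit
`BlowupExit.hasResolution_of_isBlowup_locally_regular`.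
-/

-- single-problem summit: the doubled namespace component `ResolutionOfSingularities` is forced
set_option linter.dupNamespace false

noncomputable section

open CategoryTheory AlgebraicGeometry TopologicalSpace
open Literature.AlgebraicGeometry.Resolution Literature.AlgebraicGeometry.RelativeSpec
open Literature.AlgebraicGeometry.CossartPiltant200819

namespace Summit.ResolutionOfSingularities.ResolutionOfSingularities.Theorems.WildQuotientResolution.ToricExit

/-- If `M` pulls back to `⊤`, then `L · (L² : M)` pulls back to `(pull-back of L)³` (order theory:
`L² ≤ (L² : M)` and `M · (L² : M) ≤ L²`). [folklore] -/
theorem comap_mul_colon_sq_eq_pow_three {X Y : Scheme.{0}} (f : X ⟶ Y) (L M : Y.IdealSheafData)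
    (hM : M.comap f = ⊤) : (L * colon (L ^ 2) M).comap f = L.comap f ^ 3 := by
  have h1 : (colon (L ^ 2) M).comap f = L.comap f ^ 2 := by
    apply le_antisymm
    · have h : (M * colon (L ^ 2) M).comap f ≤ (L ^ 2).comap f :=
        Scheme.IdealSheafData.comap_mono f (mul_colon_le (L ^ 2) M)
      rw [comap_mul, hM, Scheme.IdealSheafData.top_mul, comap_pow] at h
      exact h
    · rw [← comap_pow]
      exact Scheme.IdealSheafData.comap_mono f (le_colon_self (L ^ 2) M)
  rw [comap_mul, h1, pow_succ' (L.comap f) 2]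

-- the glued-quotient / blow-up bookkeeping is individually cheap but numerous
set_option maxHeartbeats 800000 in
/-- **The toric exit transfer, four pieces, ONE-SHOT colon centre on piece `0`.** As
`toricExitTransfer₄` (p525488) — crux data, equivariant proper birational integral model `V` with
action `ρB`, four `G`-stable pieces `O₀ … O₃` affine over `X₁` covering `V`, `O₃` terminal
(non-empty, regular, principal stalk augmentations), `T ⊆ V` closed missing `O₃`, `T' ⊆ V` CLOSED
missing `O₁, O₂, O₃`, one-blow-up bricks `hP₁, hP₂` along the reduced images of `T ∩ Oᵢ` — but the
piece-`0` brick is ONE-SHOT: for the closed images `Z₀, A₀ ⊆ O₀/G` of `T ∩ O₀`, `T' ∩ O₀`, SOME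
blow-up of `O₀/G` along `𝓘_{Z₀} · (𝓘_{Z₀}² : 𝓘_{A₀})` is regular. Then `X₁` has a resolution of
singularities. [OURS · L1 W4.5c] [folklore; assembly of landed decls] -/
theorem toricExitTransfer₄' (p : ℕ) (hp : p.Prime) (k : Type) [Field k]
    (X' X₁ : Scheme.{0}) (f : X₁ ⟶ Spec (.of k)) (q : X' ⟶ X₁) (G : Type) [Group G] [Finite G]
    (ρ : G →* Aut X') (hcard : Nat.card G = p) (hfaith : Function.Injective ρ)
    [IsAffine X₁] [LocallyOfFiniteType f] [IsIntegral X₁] [IsIntegral X']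
    [IsFinite q] (hdim : ¬ topologicalKrullDim X₁ ≤ 0) (hsurj : Function.Surjective q.base)
    (hU : ∃ U : X₁.Opens, Dense (U : Set X₁) ∧ Etale (q ∣_ U))
    (horb : ∀ x y : X', q.base x = q.base y → ∃ g : G, (ρ g).hom.base x = y)
    (V : Scheme.{0}) (π : V ⟶ X') [IsProper π] (hbir : IsBirational π) [IsIntegral V]
    (ρB : ActionOver (π ≫ q) G)
    (hequiv : ∀ g : G, (ρB.aut g).hom ≫ π = π ≫ (ρ g).hom)
    (O₀ O₁ O₂ O₃ : ρB.StableAffineOpens) (hcov₄ : O₀.1 ⊔ O₁.1 ⊔ O₂.1 ⊔ O₃.1 = ⊤)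
    (hO₃ne : ((O₃.1 : V.Opens) : Set V).Nonempty)
    (hreg₃ : Scheme.IsRegular (O₃.1 : Scheme.{0}))
    (hdiv₃ : ∀ (g : G) (v : V) (hv : (ρB.aut g).hom.base v = v), v ∈ (O₃.1 : V.Opens) →
      (Ideal.span (Set.range fun s : V.presheaf.stalk v =>
        (V.presheaf.stalkSpecializes (specializes_of_eq hv) ≫ (ρB.aut g).hom.stalkMap v).hom s -
          s)).IsPrincipal)
    (T : Set V) (hT : IsClosed T) (hT₃ : Disjoint T ((O₃.1 : V.Opens) : Set V))
    (T' : Set V) (hT' : IsClosed T') (hT'₁ : Disjoint T' ((O₁.1 : V.Opens) : Set V))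
    (hT'₂ : Disjoint T' ((O₂.1 : V.Opens) : Set V)) (hT'₃ : Disjoint T' ((O₃.1 : V.Opens) : Set V))
    (hP₁ : ∀ (Z₁ : Closeds (ρB.pieceQuot O₁)),
      (Z₁ : Set (ρB.pieceQuot O₁)) = (ρB.pieceMk O₁).base '' (O₁.1.ι.base ⁻¹' T) →
      ∃ (B : Scheme.{0}) (pB : B ⟶ ρB.pieceQuot O₁),
        IsBlowup pB (Scheme.IdealSheafData.vanishingIdeal Z₁) ∧ Scheme.IsRegular B)
    (hP₂ : ∀ (Z₂ : Closeds (ρB.pieceQuot O₂)),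
      (Z₂ : Set (ρB.pieceQuot O₂)) = (ρB.pieceMk O₂).base '' (O₂.1.ι.base ⁻¹' T) →
      ∃ (B : Scheme.{0}) (pB : B ⟶ ρB.pieceQuot O₂),
        IsBlowup pB (Scheme.IdealSheafData.vanishingIdeal Z₂) ∧ Scheme.IsRegular B)
    (hP₀ : ∀ (Z₀ A₀ : Closeds (ρB.pieceQuot O₀)),
      (Z₀ : Set (ρB.pieceQuot O₀)) = (ρB.pieceMk O₀).base '' (O₀.1.ι.base ⁻¹' T) →
      (A₀ : Set (ρB.pieceQuot O₀)) = (ρB.pieceMk O₀).base '' (O₀.1.ι.base ⁻¹' T') →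
      ∃ (B : Scheme.{0}) (pB : B ⟶ ρB.pieceQuot O₀),
        IsBlowup pB (Scheme.IdealSheafData.vanishingIdeal Z₀ *
          colon (Scheme.IdealSheafData.vanishingIdeal Z₀ ^ 2)
            (Scheme.IdealSheafData.vanishingIdeal A₀)) ∧ Scheme.IsRegular B) :
    Scheme.HasResolution X₁ := by
  classical
  -- separatedness and noetherianity
  haveI : X₁.IsSeparated := inferInstance
  haveI : X'.IsSeparated := ⟨by rw [← Limits.terminal.comp_from q]; infer_instance⟩
  haveI : IsLocallyNoetherian X₁ := LocallyOfFiniteType.isLocallyNoetherian f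
  -- the cover by `G`-stable opens affine over `X₁`
  have hcov : ∀ v : V, ∃ O : ρB.StableAffineOpens, v ∈ O.1 := by
    intro v
    have hv : v ∈ O₀.1 ⊔ O₁.1 ⊔ O₂.1 ⊔ O₃.1 := by rw [hcov₄]; exact Opens.mem_top v
    rcases Opens.mem_sup.mp hv with h | h
    · rcases Opens.mem_sup.mp h with h' | h'
      · rcases Opens.mem_sup.mp h' with h'' | h''
        · exact ⟨O₀, h''⟩
        · exact ⟨O₁, h''⟩
      · exact ⟨O₂, h'⟩
    · exact ⟨O₃, h⟩
  -- `Y = V/G`: integral, proper and birational over `X₁`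
  obtain ⟨hY, hr, hrbir⟩ := QuotientModel.quotientModel_proper_birational k X' X₁ f q G ρ hfaith
    hdim hsurj hU horb V π hbir ρB hequiv hcov
  haveI := hY
  haveI : IsLocallyNoetherian ρB.glued :=
    LocallyOfFiniteType.isLocallyNoetherian (ρB.gluedDesc (π ≫ q) ρB.aut_comp ≫ f)
  haveI : ∀ O : ρB.StableAffineOpens, IsLocallyNoetherian (ρB.pieceQuot O) := fun O =>
    LocallyOfFiniteType.isLocallyNoetherian (ρB.gluedι O)
  -- piece `3` is regular
  have hQ : Scheme.IsRegular (ρB.pieceQuot O₃) :=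
    isRegular_pieceQuot_of_stalkAug ρB hp hcard O₃ hO₃ne hreg₃ hdiv₃
  -- membership in a chart downstairs is membership in the stable open upstairs
  have mem_range : ∀ (O : ρB.StableAffineOpens) (v : V),
      (ρB.gluedMk hcov).base v ∈ (ρB.gluedι O).opensRange ↔ v ∈ O.1 := by
    intro O v
    change v ∈ ρB.gluedMk hcov ⁻¹ᵁ (ρB.gluedι O).opensRange ↔ _
    rw [ρB.preimage_opensRange_gluedι hcov O]
  -- the two closed sets downstairs and their ideal sheaves
  let Z : Closeds ρB.glued := ⟨(ρB.gluedMk hcov).base '' T, isClosed_gluedMk_image' ρB hcov T hT⟩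
  let A : Closeds ρB.glued :=
    ⟨(ρB.gluedMk hcov).base '' T', isClosed_gluedMk_image' ρB hcov T' hT'⟩
  have hZcoe : (Z : Set ρB.glued) = (ρB.gluedMk hcov).base '' T := rfl
  have hAcoe : (A : Set ρB.glued) = (ρB.gluedMk hcov).base '' T' := rfl
  have hZ₃ : Disjoint ((ρB.gluedMk hcov).base '' T) ((ρB.gluedι O₃).opensRange : Set ρB.glued) :=
    BlowupExit.gluedMk_image_disjoint_opensRange ρB hcov T O₃ hT₃
  have hA₁ : Disjoint ((ρB.gluedMk hcov).base '' T') ((ρB.gluedι O₁).opensRange : Set ρB.glued) :=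
    BlowupExit.gluedMk_image_disjoint_opensRange ρB hcov T' O₁ hT'₁
  have hA₂ : Disjoint ((ρB.gluedMk hcov).base '' T') ((ρB.gluedι O₂).opensRange : Set ρB.glued) :=
    BlowupExit.gluedMk_image_disjoint_opensRange ρB hcov T' O₂ hT'₂
  have hA₃ : Disjoint ((ρB.gluedMk hcov).base '' T') ((ρB.gluedι O₃).opensRange : Set ρB.glued) :=
    BlowupExit.gluedMk_image_disjoint_opensRange ρB hcov T' O₃ hT'₃
  let 𝓘 : ρB.glued.IdealSheafData := Scheme.IdealSheafData.vanishingIdeal Z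
  let 𝓘A : ρB.glued.IdealSheafData := Scheme.IdealSheafData.vanishingIdeal A
  let 𝓘' : ρB.glued.IdealSheafData := 𝓘 * colon (𝓘 ^ 2) 𝓘A
  -- `𝓘' ≠ ⊥`: its support lies in `Z`, which the non-empty chart `O₃/G` misses
  have h𝓘' : 𝓘' ≠ ⊥ := by
    intro hbot
    have hsupp : 𝓘'.support = ⊤ := Scheme.IdealSheafData.support_eq_top_iff.mpr hbot
    have hle : 𝓘'.support ≤ Z := by
      have h1 : (colon (𝓘 ^ 2) 𝓘A).support ≤ 𝓘.support := by
        have := Scheme.IdealSheafData.support_antitone (le_colon_self (𝓘 ^ 2) 𝓘A)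
        rwa [Scheme.IdealSheafData.support_pow _ 2 two_ne_zero] at this
      have h2 : 𝓘'.support = 𝓘.support ⊔ (colon (𝓘 ^ 2) 𝓘A).support :=
        Scheme.IdealSheafData.support_mul _ _
      rw [h2, sup_le_iff]
      refine ⟨le_of_eq ?_, h1.trans (le_of_eq ?_)⟩ <;>
        exact Closeds.ext (Scheme.IdealSheafData.coe_support_vanishingIdeal Z)
    obtain ⟨v, hv⟩ := hO₃ne
    have hmem : (ρB.gluedMk hcov).base v ∈ (Z : Set ρB.glued) := by
      apply hle; rw [hsupp]; trivial
    exact Set.disjoint_left.mp hZ₃ hmem ((mem_range O₃ v).mpr hv)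
  -- the four charts downstairs
  let U : Fin 4 → ρB.glued.Opens :=
    ![(ρB.gluedι O₀).opensRange, (ρB.gluedι O₁).opensRange, (ρB.gluedι O₂).opensRange,
      (ρB.gluedι O₃).opensRange]
  have hUcov : ⨆ i, U i = ⊤ := by
    rw [eq_top_iff]
    rintro z -
    obtain ⟨v, rfl⟩ := ρB.gluedMk_surjective hcov z
    have hv : v ∈ O₀.1 ⊔ O₁.1 ⊔ O₂.1 ⊔ O₃.1 := by rw [hcov₄]; exact Opens.mem_top v
    rcases Opens.mem_sup.mp hv with h | h
    · rcases Opens.mem_sup.mp h with h' | h'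
      · rcases Opens.mem_sup.mp h' with h'' | h''
        · exact Opens.mem_iSup.mpr ⟨0, (mem_range O₀ v).mpr h''⟩
        · exact Opens.mem_iSup.mpr ⟨1, (mem_range O₁ v).mpr h''⟩
      · exact Opens.mem_iSup.mpr ⟨2, (mem_range O₂ v).mpr h'⟩
    · exact Opens.mem_iSup.mpr ⟨3, (mem_range O₃ v).mpr h⟩
  -- transport of `∃ regular blow-up` along `Oᵢ/G ≅ its chart`
  have key : ∀ (O : ρB.StableAffineOpens) (K : ρB.glued.IdealSheafData),
      (∃ (B : Scheme.{0}) (pB : B ⟶ ρB.pieceQuot O),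
        IsBlowup pB (K.comap (ρB.gluedι O)) ∧ Scheme.IsRegular B) →
      ∃ (B : Scheme.{0}) (pB : B ⟶ ((ρB.gluedι O).opensRange : Scheme.{0})),
        IsBlowup pB (K.comap (ρB.gluedι O).opensRange.ι) ∧ Scheme.IsRegular B := by
    intro O K hP
    obtain ⟨B, pB, hpB, hB⟩ := hP
    refine ⟨B, pB ≫ (ρB.gluedι O).isoOpensRange.hom, ?_, hB⟩
    have h' := hpB.comp_iso (ρB.gluedι O).isoOpensRange
    rwa [← Scheme.IdealSheafData.comap_comp, Scheme.Hom.isoOpensRange_inv_comp] at h'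
  -- pulled-back reduced ideal sheaves on the charts
  have hcomap : ∀ (O : ρB.StableAffineOpens) (W : Closeds ρB.glued),
      (Scheme.IdealSheafData.vanishingIdeal W).comap (ρB.gluedι O) =
      Scheme.IdealSheafData.vanishingIdeal (W.preimage (ρB.gluedι O).continuous) := fun O W =>
    comap_vanishingIdeal_of_isOpenImmersion _ _
  have hZpre : ∀ (O : ρB.StableAffineOpens),
      ((Z.preimage (ρB.gluedι O).continuous : Closeds (ρB.pieceQuot O)) : Set (ρB.pieceQuot O)) =
        (ρB.pieceMk O).base '' (O.1.ι.base ⁻¹' T) := fun O => by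
    rw [Closeds.coe_preimage, hZcoe, preimage_gluedι_image_gluedMk ρB hcov O T]
  have hApre : ∀ (O : ρB.StableAffineOpens),
      ((A.preimage (ρB.gluedι O).continuous : Closeds (ρB.pieceQuot O)) : Set (ρB.pieceQuot O)) =
        (ρB.pieceMk O).base '' (O.1.ι.base ⁻¹' T') := fun O => by
    rw [Closeds.coe_preimage, hAcoe, preimage_gluedι_image_gluedMk ρB hcov O T']
  -- `𝓘_A` pulls back to `⊤` on the charts `O₁/G, O₂/G, O₃/G`, hence `𝓘'` to `𝓘³`
  have hAtop : ∀ (O : ρB.StableAffineOpens),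
      Disjoint ((ρB.gluedMk hcov).base '' T') ((ρB.gluedι O).opensRange : Set ρB.glued) →
      𝓘A.comap (ρB.gluedι O) = ⊤ := fun O hO =>
    BlowupExit.comap_vanishingIdeal_eq_top_of_disjoint A _ (by rw [hAcoe]; exact hO.symm)
  have hcube : ∀ (O : ρB.StableAffineOpens),
      Disjoint ((ρB.gluedMk hcov).base '' T') ((ρB.gluedι O).opensRange : Set ρB.glued) →
      𝓘'.comap (ρB.gluedι O) = 𝓘.comap (ρB.gluedι O) ^ 3 := fun O hO =>
    comap_mul_colon_sq_eq_pow_three _ 𝓘 𝓘A (hAtop O hO)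
  -- the exit downstairs, then transport along `Y → X₁`
  have hres : Scheme.HasResolution ρB.glued := by
    refine BlowupExit.hasResolution_of_isBlowup_locally_regular 𝓘' h𝓘' U hUcov fun i => ?_
    fin_cases i
    · -- piece `0`: the one-shot colon brick
      refine key O₀ 𝓘' ?_
      obtain ⟨B, pB, hpB, hB⟩ := hP₀ _ _ (hZpre O₀) (hApre O₀)
      refine ⟨B, pB, ?_, hB⟩
      rw [show 𝓘'.comap (ρB.gluedι O₀) = _ from by
        rw [comap_mul, BlowupExit.comap_colon_of_isOpenImmersion, comap_pow, hcomap, hcomap]]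
      exact hpB
    · -- piece `1`
      refine key O₁ 𝓘' ?_
      obtain ⟨B, pB, hpB, hB⟩ := hP₁ _ (hZpre O₁)
      refine ⟨B, pB, ?_, hB⟩
      rw [hcube O₁ hA₁, hcomap]
      exact (BlowupExit.isBlowup_pow_iff (by norm_num)).mpr hpB
    · -- piece `2`
      refine key O₂ 𝓘' ?_
      obtain ⟨B, pB, hpB, hB⟩ := hP₂ _ (hZpre O₂)
      refine ⟨B, pB, ?_, hB⟩
      rw [hcube O₂ hA₂, hcomap]
      exact (BlowupExit.isBlowup_pow_iff (by norm_num)).mpr hpB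
    · -- piece `3`: regular, off both centres
      refine key O₃ 𝓘' ⟨ρB.pieceQuot O₃, 𝟙 _, ?_, hQ⟩
      rw [hcube O₃ hA₃,
        BlowupExit.comap_vanishingIdeal_eq_top_of_disjoint Z _ (by rw [hZcoe]; exact hZ₃.symm),
        ← Scheme.IdealSheafData.one_eq_top, one_pow, Scheme.IdealSheafData.one_eq_top]
      exact isBlowup_id_top _
  exact QuotientModel.hasResolution_of_hasResolution_glued k X' X₁ f q G ρ hfaith hdim hsurj hU
    horb V π hbir ρB hequiv hcov hres

end Summit.ResolutionOfSingularities.ResolutionOfSingularities.Theorems.WildQuotientResolution.ToricExit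

end
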